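import Summits.HodgeConjecture.HodgeConjecture.Theorems.HeckePrymWeilHeckePrymAnchorsOfStubs
import Summits.HodgeConjecture.HodgeConjecture.Theorems.HeckePrymWeilHeckePrymAnchorsUpgrade
import Summits.HodgeConjecture.HodgeConjecture.Theorems.HeckePrymWeilHeckePrymAnchorsGlobalClassOfSection
import Summits.HodgeConjecture.HodgeConjecture.Theorems.HeckePrymWeilHeckePrymAnchorsRationalAlongSection
import Literature.AlgebraicGeometry.HodgeTheory.WeilFamilyFlatSections
import HarnessLib

/-!
# `HeckePrymAnchors` modulo four named facts of the tree (item stmt-HodgeConjecture-14496, route HeckePrymWeil)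

The crux `HeckePrymAnchors` of route `HeckePrymWeil` — uniform anchor supply: for every prime
`p ≡ 3 (4)`, `p ≥ 7`, every `g ≥ 2`, `k = n + 1 = (p-1)/2 · (g-1)`, and every `√-p`-abelian `2n`-fold
`(A, φ)`, a Weil SURFACE `(B, ψ)` (with a non-zero rational `(1,1)` class in its typed Weil plane) such
that every rational `(k,k)` class `c` of the typed Weil plane of `(A × B, φ × ψ)` is ANCHORED in a smooth
projective family of `√-p`-abelian `2k`-folds over a smooth irreducible base, by a global class `W` that is
fibrewise rational of type `(k,k)`, restricts to `c` at `A × B` and to an ALGEBRAIC class at some fibre —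
is here derived from exactly four published theorems, all recorded as named facts of the tree and taken as
hypotheses (so the result is CONDITIONAL on them and on nothing else):

* `hD  : HodgeTheory.deligne_globalInvariantCycles` — Deligne, *Théorie de Hodge II*, Thm 4.1.1 (théorème de
  la partie fixe) = Charles–Schnell Thm 11.3.4;
* `hHir` : the body of `HodgeTheory.Hironaka1964_smoothCompactification` — Hironaka 1964, Main Theorem I
  (a smooth quasi-projective irreducible complex variety is an open subscheme of a smooth projective one);
  spelled out because the declaring module is not yet built on the farm (definitionally the same statement);
* `hCS : HodgeTheory.charlesSchnell_hodgeClass_of_flat` — Charles–Schnell Prop. 11.3.5 (1) (a flat rational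
  section that is a Hodge class at one point is a Hodge class everywhere);
* `hWF : HodgeTheory.deligne1982_weilFamily_flatWeilSection` — Deligne, LNM 900 I, proof of Thm 4.8
  (pp. 47–52) with van Geemen LNM 1594 §5.3–5.11 and André 1996 Lemme 6.3.3: the polarized `ℚ(√-p)`-Weil
  family through `X` (embedded smooth projective family over a smooth quasi-projective irreducible base,
  every fibre a `√-p`-abelian `2k`-fold) with a CONTINUOUS (flat) Weil section through `c` and a fibre
  `K`-isogenous to a tensor point `(A₁ × A₁, companion)` at which the section lies in the strong Weil plane.

Everything else is PROVED in the tree (namespace `…Theorems.HeckePrymWeilLine`, all landed as supports of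
this item) and is assembled by the landed composition `heckePrymAnchors_of_stubs`
(`Theorems/HeckePrymWeilHeckePrymAnchorsOfStubs.lean`): the companion Weil surface `B = E × E`, `ψ` the
companion matrix of `T² + p` (`stub_weilSurface`); the typing upgrade from the crux's single-operator Weil
plane `Eig((𝟙+Φ)^*, (1±i√p)^{2k})` to the strong plane `weilClassesOf` (`stub_upgrade`, unconditional:
the `⋀•H¹` dictionary `up_exteriorH1`); the `c = 0` branch by the constant family over the point
(`owf_anchored_zero`); the global class of a flat section from the partie fixe + Hironaka
(`stub_globalClassOfSection`); rationality along a flat section (`stub_rationalAlongSection`); Deligne's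
tensor-point anchor `weilClassesOf (A₁ × A₁) companion ≤ algebraicClasses` (`stub_pointClassAnchor`,
Lemma 4.5 / Remark 4.10 of LNM 900, proved by Künneth + point-class pull-backs) moved across the isogeny
pair (`stub_isogenyTransfer`); transport of algebraicity along the fibre isomorphism (the route's proved
support `IsoInvariance`). This file introduces no definition; it is the line lead's skeleton
`Cruxes/HeckePrymAnchors/Lines/Sketch.lean` (v4) with its four fact-stubs turned into hypotheses.
-/

noncomputable section

-- every declaration of this problem lives in `Summit.HodgeConjecture.HodgeConjecture.…` (summit = sub-problem)
set_option linter.dupNamespace false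

open CategoryTheory AlgebraicGeometry Limits MonoidalCategory CartesianMonoidalCategory

namespace Summit.HodgeConjecture.HodgeConjecture.Theorems.HeckePrymWeilLine

open Literature.AlgebraicGeometry Literature.AlgebraicGeometry.Motives Literature.AlgebraicGeometry.HodgeTheory
open Summit.HodgeConjecture.HodgeConjecture.Theses.HeckePrymWeil

/-- **`HeckePrymAnchors` from four named facts of the tree** (CONDITIONAL result): the théorème de la
partie fixe `deligne_globalInvariantCycles`, Hironaka's smooth projective compactification (body of
`Hironaka1964_smoothCompactification`), Charles–Schnell Prop. 11.3.5 (1)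
`charlesSchnell_hodgeClass_of_flat`, and Deligne's Weil family with a flat Weil section and a tensor-split
fibre `deligne1982_weilFamily_flatWeilSection` together imply the crux. Proof: the landed composition
`heckePrymAnchors_of_stubs` with its three provable hypotheses discharged by the landed `stub_upgrade`,
`stub_globalClassOfSection`, `stub_rationalAlongSection`. For the rational `(k,k)` class `c ≠ 0` of the
typed Weil plane of `(A × B, φ × ψ)`, `B = E × E` the companion surface: upgrade `c` to the strong Weil
plane, take the Weil family `f : 𝒳 → S` through `A × B` with its flat section `σ` through `c` (`hWF`),
globalise `σ` to one class `W ∈ H^{2k}(𝒳(ℂ); ℂ)` (`hD`, `hHir`), propagate rationality and — by `hCS` —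
Hodge type `(k,k)` along `σ`, and read algebraicity of `W` at the tensor-split fibre from Deligne's
tensor-point anchor across the isogeny pair and the fibre isomorphism; `c = 0` is anchored by the
constant family. [cite: Deligne1982HodgeCycles, proof of Thm. 4.8 (pp. 47–52), Lemma 4.5, Remark 4.10]
[cite: DeligneHodgeII1971, Théorème 4.1.1] [cite: CharlesSchnell2014Notes, Thm. 11.3.4 and Prop. 11.3.5 (1)]
[cite: Hironaka1964, Main Theorem I] [cite: vanGeemen1994HodgeAV, §5.3–5.11] [cite: Andre1996Motifs, Lemme 6.3.3] -/
theorem heckePrymAnchors_of_facts :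
    (deligne_globalInvariantCycles) → (∀ (m : ℕ) (T : SchemeOver ℂ), SmoothOfRelativeDimension m T.hom → IsQuasiProjectiveOver T → IrreducibleSpace T.left → ∃ (Tbar : SchemeOver ℂ) (i : T ⟶ Tbar), IsSmoothProjective m Tbar ∧ IsOpenImmersion i.left) → (charlesSchnell_hodgeClass_of_flat) → (deligne1982_weilFamily_flatWeilSection) → Summit.HodgeConjecture.HodgeConjecture.Theses.HeckePrymWeil.HeckePrymAnchors :=
  fun hD hHir hCS hWF =>
    heckePrymAnchors_of_stubs stub_upgrade stub_globalClassOfSection stub_rationalAlongSection hD hHir hCS hWF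

end Summit.HodgeConjecture.HodgeConjecture.Theorems.HeckePrymWeilLine

end
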